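import Literature.MathematicalPhysics.QuantumFieldTheory.Balaban1983to89.Node00.Record12
import Literature.MathematicalPhysics.QuantumFieldTheory.Balaban1983to89.Node00.RateRecord11

/-!
# NODE 00 (YM-PLAN Track A) — THE DATUM-LEVEL KEY OF THE TWO CARRIER RECORDS AT STAGE 12: «`D` is a datum of record, Stage 12» (`IsDatumOfRecord₁₂C`), THE CANONICAL
# STAGE-12 PARAMETER OF SUCH A DATUM (`IsDatumOfRecord₁₂C.params ∕ .provisos`, by choice), its faces, the canonicalised readings (`canon₁₂`), and the θ-exposed
# record key and residual assignments of the rate-record home at Stage 12 (`IsRateKey₁₂`, `RateAssignment₁₂`, `SpineAssignment₁₂`)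

NODE 00 RECORD MODULE (cell `pub-ymgap`, seat `pub-ymgap-node00-def-RR-2` gen 2 = second reader ∕ key + instance side of the RATE-RECORD HOME, director-ym R141 (A);
dag-lead WORDS-99 ∕ WORDS-101).  THE STAGE-12 RE-KEY of this seat's `Node00/Record11DatumKey` (gen 0) and of the three Stage-typed declarations of RR-1's
`Node00/RateRecord11` §1 ∕ §6 (`IsRateKey₁₁`, `RateAssignment₁₁`, `SpineAssignment₁₁`), over seat def-T's `Node00/Record12` (the Stage-12 record: 𝐓-weights pinned,
by-value dichotomy, level-0 background repaired, the uninhabitable proviso field `alphaPos` dropped).  APPEND-ONLY: a NEW module importing `Node00/Record12` and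
`Node00/RateRecord11` (whose stage-free CONTAINERS `U3Letters₁₁ ∕ U3Objects₁₁ ∕ U3Tower₁₁ ∕ NE3Objects₁₁ ∕ NE2Objects₁₁ ∕ SpineObjects₁₁ ∕ RateObjects₁₁` are consumed BY
NAME, not restated); everything it reads is CONSUMED BY NAME.

WHY THIS OBJECT (unchanged from Stage 11, where it is now EMPTY).  Seat def-T LOCATED (kernel, `Node00.not_provisos₁₁` ∕ `Node00.not_isRecordOfRecord₁₁C`) that 11d's
`Stage11Params.Provisos₁₁` is uninhabited (its field `alphaPos` reads `0 < 0` at the run `⟨0, 0, 0⟩`), so the Stage-11 datum key `IsDatumOfRecord₁₁C F N D` is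
uninhabited for every `D` and every record keyed to it ((T-RATE) `YMDAG.UVSplit.RRec₁₁`, (T-SPINE) `YMDAG.UVSplit.SRec₁₁ (canonReading₁₁ ·)`) pins nothing: the six K4
stubs hold there with no estimate (`YMDAG.UVSplit.k4_rRec₁₁_of_uninhabited`).  The route's repaired items K0′–K3′ (rev 8) read `Node00.IsRecordOfRecord₁₂C`; the two
carrier records of clusters K4 ∕ K5 are read JOINTLY by the N19′ edge (`…N27AtRecordK4.spine_of_rateStubs_coreEdge` :64), so — exactly as at Stage 11 — both must be
keyed to ONE parameter per datum: THE CANONICAL STAGE-12 PARAMETER `h.params := Classical.choose h` of `h : IsDatumOfRecord₁₂C F N D`, with `h.provisos`,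
`h.admissible`, `h.eq_datumOfRecord₁₂ : D = datumOfRecord₁₂ F N h.params h.provisos`.  Every θ-level object of record `X θ hP g₀ os` then has ONE datum-level
INSTANCE `X h.params h.provisos g₀ os` per `(F, D, g₀, os)`; the intended record shapes are «`RRec₁₂ 𝔯 F D g₀ os R :↔ ∃ (h : IsDatumOfRecord₁₂C F N D) (k : ℕ),
R = rateCarriersOfRecord₁₂ 𝔯 F h.params g₀ os k`» and «`SRec₁₂ (canonReading₁₂ cr) F D g₀ os S ↔ ∃ h : IsDatumOfRecord₁₂C F N D, S = cr F h.params h.provisos g₀ os`»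
(`exists_keyed_canon₁₂_iff`), COHERENT by `keyed_canon₁₂_coherent`; a consumer proving its node AT EVERY admissible Stage-12 `θ` with provisos proves it at the
instance (`IsDatumOfRecord₁₂C.forall_params`).  `isDatumOfRecord₁₂C_iff_exists_world`: the datum class IS the `₁₂C` record class with the world forgotten, so
K0′ («`∃ D w, IsRecordOfRecord₁₂C F 2 D w`») reads the same either way (`exists_isDatumOfRecord₁₂C_iff_exists_record`) and REDUCES HONESTLY to «one admissible
Stage-12 parameter with every proviso field a theorem» (`exists_isDatumOfRecord₁₂C_iff_exists_params`; director LINE №91's K0′ components) — INHABITATION IS NOT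
CLAIMED HERE.  The companions in the carrier-pinned classes at Stage 12 (`IsRecordOfRecord₁₂CB10YZW`, `…B8`, seat node00-def's Stage-12 carrier stack) are a
v1.1 append once those modules are in the tree.

STAGE-11 VIEW.  There is NO run-free map `Stage12Params → Stage11Params` (def-T: the 𝐓-weights are pinned RUN BY RUN, `Stage12Params.toStage11 θ p`); the key is
run-free, as at Stage 11, and rate ∕ spine objects are to be read off `h.params : Stage12Params F N` (its Stage-9 part, `s2`, `Rz` carry the same field names as
`Stage11Params` — `Stage12Params extends Stage9Params` — so Stage-11-typed object constructors re-elaborate at Stage 12 textually).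

HONEST FRAMING.  Definitions of record + kernel bookkeeping (`Classical.choose`, `rfl`, ∃-repackaging); NOTHING of Bałaban's is asserted; no node is discharged; counts
unmoved; one finite four-torus programme at fixed `ε` — NOT the continuum limit on ℝ⁴, NOT infinite volume, NOT OS, NOT a mass gap, NOT the Clay problem.  No `sorry` ∕
`axiom` ∕ `opaque` ∕ `instance` ∕ `notation`.  [Balaban1989LargeFieldII] = Commun. Math. Phys. **122** (1989) 355–392; [Balaban1988Convergent] = Commun. Math. Phys.
**119** (1988) 243–285; [Balaban1987RG1] = Commun. Math. Phys. **109** (1987) 249–301.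
-/

noncomputable section

namespace Literature.MathematicalPhysics.QuantumFieldTheory.Balaban1983to89.Node00

open T4Continuum AveragingRT T4FiniteEpsInhabited FlowStep FlowStepRuns DagBinding T4DatumAssembly

/-! ## §1. «`D` is a datum of record, Stage 12» and its CANONICAL parameter -/

section DatumKey

variable (F : T4Family) (N : ℕ) [NeZero N]

/-- **«`D` is a datum of record, Stage 12 (C-class)»**: SOME admissible Stage-12 parameter satisfying its displayed provisos has `D` as its datum of record — the
datum-level shadow of `IsRecordOfRecord₁₂C` (the world forgotten; `isDatumOfRecord₁₂C_iff_exists_world`). [cite: Balaban1989LargeFieldII, Thm 1 + (0.1) pp.355–356; Balaban1988Convergent, Thms 1–2 pp.262–263 (objects of record; bookkeeping)] -/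
def IsDatumOfRecord₁₂C (D : FiniteEpsData F (SU N)) : Prop :=
  ∃ (θ : Stage12Params F N) (h : θ.Provisos₁₂ F N), θ.Admissible F N ∧ D = datumOfRecord₁₂ F N θ h

/-- Every admissible Stage-12 parameter with provisos yields a datum of record. [cite: Balaban1989LargeFieldII, Thm 1 + (0.1) pp.355–356 (bookkeeping)] -/
theorem isDatumOfRecord₁₂C_datumOfRecord₁₂ (θ : Stage12Params F N) (h : θ.Provisos₁₂ F N) (hθ : θ.Admissible F N) :
    IsDatumOfRecord₁₂C F N (datumOfRecord₁₂ F N θ h) :=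
  ⟨θ, h, hθ, rfl⟩

/-- **K0′ READS THE SAME AT THE DATUM**: some datum of record exists at `(F, N)` iff some Stage-12 record pair `(D, w)` exists (the body of the route's K0′
`Record12Inhabited` at `N`). [cite: Balaban1989LargeFieldII, Thm 1 + (0.1) pp.355–356 (bookkeeping)] -/
theorem exists_isDatumOfRecord₁₂C_iff_exists_record :
    (∃ D : FiniteEpsData F (SU N), IsDatumOfRecord₁₂C F N D) ↔ ∃ (D : FiniteEpsData F (SU N)) (w : WorldP), IsRecordOfRecord₁₂C F N D w := by
  constructor
  · rintro ⟨_, θ, hP, hθ, rfl⟩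
    obtain ⟨w, hw, -⟩ := exists_world_isRecordOfRecord₁₂C F N θ hP hθ ⟨hθ.toStage9.gamma_pos, le_rfl⟩
    exact ⟨_, w, hw⟩
  · rintro ⟨D, w, hw⟩
    exact ⟨D, exists_provisos_of_isRecordOfRecord₁₂C hw⟩

/-- **THE HONEST REDUCTION OF K0′**: some datum of record exists at `(F, N)` iff SOME Stage-12 parameter is admissible and satisfies every displayed proviso —
«exhibit ONE admissible `Stage12Params` with EVERY proviso field a theorem» (the K0′ components); inhabitation is NOT claimed in this module.
[cite: Balaban1988Convergent, (2.7) p.255, (2.21) p.258, (2.28) p.259, (3.16) p.268, (3.21) p.269; Balaban1987RG1, (1.12)–(1.15) p.262 (hypothesis dictionary; bookkeeping)] -/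
theorem exists_isDatumOfRecord₁₂C_iff_exists_params :
    (∃ D : FiniteEpsData F (SU N), IsDatumOfRecord₁₂C F N D) ↔ ∃ θ : Stage12Params F N, θ.Provisos₁₂ F N ∧ θ.Admissible F N := by
  constructor
  · rintro ⟨_, θ, hP, hθ, -⟩
    exact ⟨θ, hP, hθ⟩
  · rintro ⟨θ, hP, hθ⟩
    exact ⟨_, isDatumOfRecord₁₂C_datumOfRecord₁₂ F N θ hP hθ⟩

variable {F N}
variable {D : FiniteEpsData F (SU N)} {w : WorldP}

/-- A Stage-12 record's datum is a Stage-12 datum of record. [cite: Balaban1989LargeFieldII, Thm 1 p.355 (bookkeeping)] -/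
theorem isDatumOfRecord₁₂C_of_isRecordOfRecord₁₂C (h : IsRecordOfRecord₁₂C F N D w) : IsDatumOfRecord₁₂C F N D :=
  exists_provisos_of_isRecordOfRecord₁₂C h

/-- **DATUM OF RECORD ⟺ RECORD AT SOME WORLD.** [cite: Balaban1989LargeFieldII, Thm 1 + (0.1) pp.355–356 (bookkeeping)] -/
theorem isDatumOfRecord₁₂C_iff_exists_world : IsDatumOfRecord₁₂C F N D ↔ ∃ w : WorldP, IsRecordOfRecord₁₂C F N D w := by
  constructor
  · rintro ⟨θ, hP, hθ, rfl⟩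
    obtain ⟨w, hw, -⟩ := exists_world_isRecordOfRecord₁₂C F N θ hP hθ ⟨hθ.toStage9.gamma_pos, le_rfl⟩
    exact ⟨w, hw⟩
  · rintro ⟨w, hw⟩
    exact isDatumOfRecord₁₂C_of_isRecordOfRecord₁₂C hw

/-- **THE CANONICAL STAGE-12 PARAMETER OF A DATUM OF RECORD** (choice) — the ONE key both carrier records of clusters K4 ∕ K5 are read at.
[cite: Balaban1989LargeFieldII, Thm 1 + (0.1) pp.355–356 (bookkeeping)] -/
def IsDatumOfRecord₁₂C.params (h : IsDatumOfRecord₁₂C F N D) : Stage12Params F N :=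
  Classical.choose h

/-- Its provisos. [cite: Balaban1988Convergent, (2.7) p.255, (2.21) p.258, (2.35) p.261 (bookkeeping)] -/
theorem IsDatumOfRecord₁₂C.provisos (h : IsDatumOfRecord₁₂C F N D) : h.params.Provisos₁₂ F N :=
  (Classical.choose_spec h).fst

/-- Its admissibility. [cite: Balaban1987RG1, (1.12) p.262; Balaban1988Convergent, (2.10) p.256 (bookkeeping)] -/
theorem IsDatumOfRecord₁₂C.admissible (h : IsDatumOfRecord₁₂C F N D) : h.params.Admissible F N :=
  (Classical.choose_spec h).snd.1

/-- **The datum IS the datum of record of its canonical parameter.** [cite: Balaban1989LargeFieldII, Thm 1 p.355 (bookkeeping)] -/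
theorem IsDatumOfRecord₁₂C.eq_datumOfRecord₁₂ (h : IsDatumOfRecord₁₂C F N D) : D = datumOfRecord₁₂ F N h.params h.provisos :=
  (Classical.choose_spec h).snd.2

/-- The canonical parameter's coupling window is positive. [cite: Balaban1987RG1, (0.21) p.256 (bookkeeping)] -/
theorem IsDatumOfRecord₁₂C.gamma_pos (h : IsDatumOfRecord₁₂C F N D) : 0 < h.params.γ :=
  h.admissible.toStage9.gamma_pos

/-- … and lies inside `]0, 1[` (the Stage-12 sign `γ < 1`). [cite: Balaban1988Convergent, (2.28) p.259 (bookkeeping)] -/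
theorem IsDatumOfRecord₁₂C.gamma_lt_one (h : IsDatumOfRecord₁₂C F N D) : h.params.γ < 1 :=
  h.admissible.pos₁₂.2.2.2.2

/-- **WHAT A CONSUMER PROVES ⟹ WHAT THE INSTANCE CARRIES**: a property of the objects of record established at EVERY admissible Stage-12 parameter with provisos
holds at the canonical parameter of every datum of record. [cite: Balaban1989LargeFieldII, Thm 1 p.355 (bookkeeping)] -/
theorem IsDatumOfRecord₁₂C.forall_params {P : (D : FiniteEpsData F (SU N)) → (θ : Stage12Params F N) → θ.Provisos₁₂ F N → Prop}
    (hP : ∀ (θ : Stage12Params F N) (hθ : θ.Provisos₁₂ F N), θ.Admissible F N → P (datumOfRecord₁₂ F N θ hθ) θ hθ) (h : IsDatumOfRecord₁₂C F N D) :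
    P D h.params h.provisos := by
  have := hP h.params h.provisos h.admissible
  rwa [← h.eq_datumOfRecord₁₂] at this

/-- **WORLD COMPANION IN `₁₂C` AT ANY WINDOW BELOW THE CANONICAL ONE**: for `0 < γw ≤ h.params.γ` some world makes `(D, w)` a Stage-12 record with `w.γ = γw` — what
the N17 home-keying binder («`RRec … R → ∃ w, IsRecordOfRecord₁₂C F N D w ∧ R.u3.γ = w.γ`») consumes once `R.u3.γ` is pinned in that range.
[cite: Balaban1989LargeFieldII, Thm 1 + (0.1) pp.355–356 (bookkeeping)] -/
theorem IsDatumOfRecord₁₂C.exists_world (h : IsDatumOfRecord₁₂C F N D) {γw : ℝ} (hγw : 0 < γw ∧ γw ≤ h.params.γ) :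
    ∃ w : WorldP, IsRecordOfRecord₁₂C F N D w ∧ w.γ = γw := by
  obtain ⟨w, hw, hγ⟩ := exists_world_isRecordOfRecord₁₂C F N h.params h.provisos h.admissible hγw
  exact ⟨w, h.eq_datumOfRecord₁₂ ▸ hw, hγ⟩

/-- … in particular at the canonical window `h.params.γ` itself. [cite: Balaban1989LargeFieldII, Thm 1 + (0.1) pp.355–356 (bookkeeping)] -/
theorem IsDatumOfRecord₁₂C.exists_world_gamma (h : IsDatumOfRecord₁₂C F N D) :
    ∃ w : WorldP, IsRecordOfRecord₁₂C F N D w ∧ w.γ = h.params.γ :=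
  h.exists_world ⟨h.gamma_pos, le_rfl⟩

/-- **THE DATUM's β-FUNCTIONS ARE THE β OF RECORD AT THE CANONICAL PARAMETER's STAGE-9 PART** (def-T's `βfun_datumOfRecord₁₂`, `rfl` there; def-B's
`betaOfRecord₁₁` of any Stage-11 view is the same term, `betaOfRecord₁₀ ∘ toStage9Params`, reducibly) — what the (D4) read-out binders and node N17 read off `D`.
[cite: Balaban1987RG1, (1.20)–(1.22) p.264 (bookkeeping)] -/
theorem IsDatumOfRecord₁₂C.βfun_eq_betaOfRecord₁₀ (h : IsDatumOfRecord₁₂C F N D) : D.βfun = betaOfRecord₁₀ F N h.params.toStage9Params := by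
  have := βfun_datumOfRecord₁₂ F N h.params h.provisos
  rwa [← h.eq_datumOfRecord₁₂] at this

/-- The datum's coupling flow of the run `p` IS the generated history of record of the canonical parameter's Stage-9 part (def-T's `flow_g_datumOfRecord₁₂`).
[cite: Balaban1987RG1, (0.17)–(0.20) pp.255–256 (bookkeeping)] -/
theorem IsDatumOfRecord₁₂C.flow_g (h : IsDatumOfRecord₁₂C F N D) (p : B12.RunParams) :
    (D.C p).flow.g = gOfRecord₁₀ F N h.params.toStage9Params p := by
  have := flow_g_datumOfRecord₁₂ F N h.params h.provisos p
  rwa [← h.eq_datumOfRecord₁₂] at this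

/-- The datum's averaging maps ARE the averaging maps of record. [cite: Balaban1987RG1, (0.4) p.253 (bookkeeping)] -/
theorem IsDatumOfRecord₁₂C.av_eq (h : IsDatumOfRecord₁₂C F N D) : D.av = avOfRecord F N := by
  have := av_datumOfRecord₁₂ F N h.params h.provisos
  rwa [← h.eq_datumOfRecord₁₂] at this

/-- A Stage-12 datum of record is a datum of record, Stage 0 (binder B1 ∕ node N23's reading). [cite: Balaban1987RG1, (0.3)–(0.4) p.253 (bookkeeping)] -/
theorem IsDatumOfRecord₁₂C.isDatumOfRecord₀ (h : IsDatumOfRecord₁₂C F N D) : IsDatumOfRecord₀ F N D := by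
  rw [h.eq_datumOfRecord₁₂]
  exact isDatumOfRecord₀_datumOfRecord₁₂ F N h.params h.provisos

/-- N23 · binder B1 at every Stage-12 datum of record. [cite: Balaban1987RG1, (0.4) p.253] -/
theorem IsDatumOfRecord₁₂C.isPrintedAveraged (h : IsDatumOfRecord₁₂C F N D) : D.IsPrintedAveraged := by
  rw [h.eq_datumOfRecord₁₂]
  exact isPrintedAveraged_datumOfRecord₁₂ F N h.params h.provisos

/-- The β-VERSION PROVISO at the canonical parameter (what the β-side seats N26 ∕ N28 and NODE O's J-11 read): the Stage-8 part has a continuous-version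
transport along the tower (def-T's `Provisos₁₂.hasContTransportAlong`). [cite: Balaban1987RG1, (0.13) p.254, (1.20)–(1.22) p.264 (bookkeeping)] -/
theorem IsDatumOfRecord₁₂C.hasContTransportAlong (h : IsDatumOfRecord₁₂C F N D) : h.params.toStage8Params.HasContTransportAlong :=
  h.provisos.hasContTransportAlong

/-- **THE ₅C SHADOW AT THE CANONICAL PARAMETER**: a Stage-12 datum of record is refined by a Stage-5 C-bound record at some world (def-T's
`exists_isRecordOfRecord₅C_of_isRecordOfRecord₁₂C` through the world companion) — for consumers keyed at ₅C. [cite: Balaban1989LargeFieldII, Thm 1 + (0.1) pp.355–356 (bookkeeping)] -/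
theorem IsDatumOfRecord₁₂C.exists_isRecordOfRecord₅C (h : IsDatumOfRecord₁₂C F N D) :
    ∃ (D₅ : FiniteEpsData F (SU N)) (w : WorldP), IsRecordOfRecord₅C F N D₅ w ∧ D₅.C = D.C ∧ (∀ K g₀ k, D₅.dens K g₀ k = D.dens K g₀ k) ∧
      D₅.βfun = D.βfun ∧ D₅.av = D.av := by
  obtain ⟨w, hw, -⟩ := h.exists_world_gamma
  obtain ⟨D₅, h₅⟩ := exists_isRecordOfRecord₅C_of_isRecordOfRecord₁₂C hw
  exact ⟨D₅, w, h₅⟩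

end DatumKey

/-! ## §2. Canonicalised readings — COHERENCE for records keyed «`∃ θ hP, θ.Admissible F N ∧ D = datumOfRecord₁₂ F N θ hP ∧ S = cr F θ hP …`»

Reading an existentially keyed record through `canon₁₂ f` makes the admitted bundle a function of the DATUM: `canon₁₂ f θ hP = f h.params h.provisos` whenever
`datumOfRecord₁₂ F N θ hP = D` and `h : IsDatumOfRecord₁₂C F N D` (`canon₁₂_eq_of_eq`), so two records keyed independently but read through `canon₁₂` admit, at the
same `(F, D, g₀, os)`, bundles read at the SAME parameter (`exists_keyed_canon₁₂_iff` turns either key into «`∃ h : IsDatumOfRecord₁₂C F N D, Φ (f h.params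
h.provisos)`»).  Off the datum-of-record class `canon₁₂ f = f`. -/
section Canon

variable (F : T4Family) (N : ℕ) [NeZero N] {α : Sort*}

/-- **CANONICALISED READING**: read `f` at the canonical parameter of the datum `datumOfRecord₁₂ F N θ hP` when that datum is of record (admissible), else at
`(θ, hP)` itself.  Kernel bookkeeping (`Classical.dec`, `dite`). [cite: Balaban1989LargeFieldII, Thm 1 + (0.1) pp.355–356 (bookkeeping)] -/
def canon₁₂ (f : (θ : Stage12Params F N) → θ.Provisos₁₂ F N → α) (θ : Stage12Params F N) (hP : θ.Provisos₁₂ F N) : α := by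
  classical
  exact if h : IsDatumOfRecord₁₂C F N (datumOfRecord₁₂ F N θ hP) then f h.params h.provisos else f θ hP

variable {F N}

/-- The canonical parameter depends on the datum only: transport of the key along `D = D'` does not change `.params` (proof irrelevance + `subst`).
[cite: Balaban1989LargeFieldII, Thm 1 + (0.1) pp.355–356 (bookkeeping)] -/
theorem IsDatumOfRecord₁₂C.params_congr {D D' : FiniteEpsData F (SU N)} (h : IsDatumOfRecord₁₂C F N D) (h' : IsDatumOfRecord₁₂C F N D') (e : D = D') :
    h.params = h'.params := by
  subst e
  rfl

/-- **`canon₁₂ f θ hP = f h.params h.provisos`** whenever `(θ, hP)` realises a datum of record `D` with key `h`. [cite: Balaban1989LargeFieldII, Thm 1 + (0.1) pp.355–356 (bookkeeping)] -/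
theorem canon₁₂_eq_of_eq {f : (θ : Stage12Params F N) → θ.Provisos₁₂ F N → α} {D : FiniteEpsData F (SU N)} (h : IsDatumOfRecord₁₂C F N D)
    (θ : Stage12Params F N) (hP : θ.Provisos₁₂ F N) (e : D = datumOfRecord₁₂ F N θ hP) :
    canon₁₂ F N f θ hP = f h.params h.provisos := by
  subst e
  unfold canon₁₂
  rw [dif_pos h]

/-- At the canonical parameter itself `canon₁₂ f` reads `f`. [cite: Balaban1989LargeFieldII, Thm 1 + (0.1) pp.355–356 (bookkeeping)] -/
theorem canon₁₂_params {f : (θ : Stage12Params F N) → θ.Provisos₁₂ F N → α} {D : FiniteEpsData F (SU N)} (h : IsDatumOfRecord₁₂C F N D) :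
    canon₁₂ F N f h.params h.provisos = f h.params h.provisos :=
  canon₁₂_eq_of_eq h h.params h.provisos h.eq_datumOfRecord₁₂

/-- At an admissible tuple with provisos, `canon₁₂ f` reads `f` at the canonical parameter of ITS datum. [cite: Balaban1989LargeFieldII, Thm 1 + (0.1) pp.355–356 (bookkeeping)] -/
theorem canon₁₂_eq_of_admissible {f : (θ : Stage12Params F N) → θ.Provisos₁₂ F N → α} (θ : Stage12Params F N) (hP : θ.Provisos₁₂ F N) (hθ : θ.Admissible F N) :
    canon₁₂ F N f θ hP = f (isDatumOfRecord₁₂C_datumOfRecord₁₂ F N θ hP hθ).params (isDatumOfRecord₁₂C_datumOfRecord₁₂ F N θ hP hθ).provisos :=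
  canon₁₂_eq_of_eq _ θ hP rfl

/-- Off the datum-of-record class nothing is canonicalised. [cite: Balaban1989LargeFieldII, Thm 1 + (0.1) pp.355–356 (bookkeeping)] -/
theorem canon₁₂_eq_self_of_not {f : (θ : Stage12Params F N) → θ.Provisos₁₂ F N → α} (θ : Stage12Params F N) (hP : θ.Provisos₁₂ F N)
    (hn : ¬ IsDatumOfRecord₁₂C F N (datumOfRecord₁₂ F N θ hP)) : canon₁₂ F N f θ hP = f θ hP := by
  unfold canon₁₂
  rw [dif_neg hn]

/-- **THE KEYED-RECORD FACE**: an existentially keyed record («some admissible `θ` with provisos realises `D` and the bundle reads `canon₁₂ f` there») IS the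
datum-keyed record («the bundle reads `f` at the canonical parameter of `D`») — for every property `Φ` of the reading (e.g. `Φ x := S = x g₀ os`).  This is the
sentence that makes (T-SPINE)'s and (T-RATE)'s Stage-12 records COHERENT. [cite: Balaban1989LargeFieldII, Thm 1 + (0.1) pp.355–356 (bookkeeping)] -/
theorem exists_keyed_canon₁₂_iff {f : (θ : Stage12Params F N) → θ.Provisos₁₂ F N → α} {D : FiniteEpsData F (SU N)} (Φ : α → Prop) :
    (∃ (θ : Stage12Params F N) (hP : θ.Provisos₁₂ F N), θ.Admissible F N ∧ D = datumOfRecord₁₂ F N θ hP ∧ Φ (canon₁₂ F N f θ hP)) ↔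
      ∃ h : IsDatumOfRecord₁₂C F N D, Φ (f h.params h.provisos) := by
  constructor
  · rintro ⟨θ, hP, hθ, e, hΦ⟩
    have h : IsDatumOfRecord₁₂C F N D := ⟨θ, hP, hθ, e⟩
    refine ⟨h, ?_⟩
    rwa [canon₁₂_eq_of_eq (f := f) h θ hP e] at hΦ
  · rintro ⟨h, hΦ⟩
    refine ⟨h.params, h.provisos, h.admissible, h.eq_datumOfRecord₁₂, ?_⟩
    rwa [canon₁₂_params (f := f) h]

/-- **COHERENCE**: two existentially keyed records read through `canon₁₂` admit, at the same datum, readings AT THE SAME PARAMETER.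
[cite: Balaban1989LargeFieldII, Thm 1 + (0.1) pp.355–356 (bookkeeping)] -/
theorem keyed_canon₁₂_coherent {β : Sort*} {f : (θ : Stage12Params F N) → θ.Provisos₁₂ F N → α} {g : (θ : Stage12Params F N) → θ.Provisos₁₂ F N → β}
    {D : FiniteEpsData F (SU N)} (Φ : α → Prop) (Ψ : β → Prop)
    (hΦ : ∃ (θ : Stage12Params F N) (hP : θ.Provisos₁₂ F N), θ.Admissible F N ∧ D = datumOfRecord₁₂ F N θ hP ∧ Φ (canon₁₂ F N f θ hP))
    (hΨ : ∃ (θ : Stage12Params F N) (hP : θ.Provisos₁₂ F N), θ.Admissible F N ∧ D = datumOfRecord₁₂ F N θ hP ∧ Ψ (canon₁₂ F N g θ hP)) :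
    ∃ h : IsDatumOfRecord₁₂C F N D, Φ (f h.params h.provisos) ∧ Ψ (g h.params h.provisos) := by
  obtain ⟨h, h₁⟩ := (exists_keyed_canon₁₂_iff Φ).1 hΦ
  obtain ⟨h', h₂⟩ := (exists_keyed_canon₁₂_iff Ψ).1 hΨ
  exact ⟨h, h₁, h₂⟩

end Canon

/-! ## §3. The θ-exposed Stage-12 record key and the residual assignments of the rate-record home at Stage 12
(RR-1's `Node00/RateRecord11` §1 ∕ §6 restated `11 ↦ 12`; the object containers are RR-1's, by name) -/

section Key

variable (F : T4Family) (N : ℕ) [NeZero N]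

/-- **«(D, w) is the Stage-12 record WITH PARAMETERS θ»**: the body of `IsRecordOfRecord₁₂C F N D w` with the Stage-12 parameter EXPOSED — θ is admissible and
satisfies its displayed provisos, its datum of record IS `D`, and the world `w` is bound to the construction with a window `0 < w.γ ≤ θ.γ`, Bałaban's block size and
the C-binding of record over the Stage-12 view. [cite: Balaban1989LargeFieldII, Thm 1 + (0.1) pp.355–356; Balaban1987RG1, (0.24)–(0.25) p.257 (objects of record; bookkeeping)] -/
def IsRateKey₁₂ (D : FiniteEpsData F (SU N)) (w : WorldP) (θ : Stage12Params F N) : Prop :=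
  ∃ h : θ.Provisos₁₂ F N, θ.Admissible F N ∧ D = datumOfRecord₁₂ F N θ h ∧ w.C = D.C ∧ (0 < w.γ ∧ w.γ ≤ θ.γ) ∧
    w.L = (θ.L : ℝ) ∧ ∀ P : B12.RunParams, w.up P = upOfRecord₅C F N (θ.toStage5₁₂ F N) P

/-- **A Stage-12 record IS a keyed record for SOME θ, and conversely** (`Iff.rfl`: the key is `IsRecordOfRecord₁₂C`'s body). [cite: Balaban1989LargeFieldII, Thm 1 + (0.1) pp.355–356 (bookkeeping)] -/
theorem isRecordOfRecord₁₂C_iff_exists_isRateKey₁₂ (D : FiniteEpsData F (SU N)) (w : WorldP) :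
    IsRecordOfRecord₁₂C F N D w ↔ ∃ θ : Stage12Params F N, IsRateKey₁₂ F N D w θ := Iff.rfl

/-- **Pointed form of the key** at the datum of record. [cite: Balaban1989LargeFieldII, Thm 1 + (0.1) pp.355–356 (bookkeeping)] -/
theorem isRateKey₁₂_of_eq (θ : Stage12Params F N) (h : θ.Provisos₁₂ F N) (hθ : θ.Admissible F N) (w : WorldP)
    (hC : w.C = (datumOfRecord₁₂ F N θ h).C) (hγ : 0 < w.γ ∧ w.γ ≤ θ.γ) (hL : w.L = (θ.L : ℝ))
    (hup : ∀ P, w.up P = upOfRecord₅C F N (θ.toStage5₁₂ F N) P) :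
    IsRateKey₁₂ F N (datumOfRecord₁₂ F N θ h) w θ :=
  ⟨h, hθ, rfl, hC, hγ, hL, hup⟩

/-- **Every admissible θ satisfying its provisos is keyed at some world with any window `0 < γw ≤ θ.γ`** — inhabitation of the keyed class is Stage 12's exactly.
[cite: Balaban1989LargeFieldII, Thm 1 + (0.1) pp.355–356 (bookkeeping)] -/
theorem exists_world_isRateKey₁₂ (θ : Stage12Params F N) (h : θ.Provisos₁₂ F N) (hθ : θ.Admissible F N) {γw : ℝ} (hγw : 0 < γw ∧ γw ≤ θ.γ) :
    ∃ w : WorldP, IsRateKey₁₂ F N (datumOfRecord₁₂ F N θ h) w θ ∧ w.γ = γw := by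
  obtain ⟨w₀⟩ := nonempty_worldP
  exact ⟨{ w₀ with
      C := (datumOfRecord₁₂ F N θ h).C, γ := γw, L := (θ.L : ℝ), one_lt_L := by exact_mod_cast θ.hL.2,
      up := fun P => upOfRecord₅C F N (θ.toStage5₁₂ F N) P },
    ⟨h, hθ, rfl, rfl, hγw, rfl, fun _ => rfl⟩, rfl⟩

variable {F N}
variable {D : FiniteEpsData F (SU N)} {w : WorldP} {θ : Stage12Params F N}

/-- A keyed record is a Stage-12 record. [cite: Balaban1989LargeFieldII, Thm 1 + (0.1) pp.355–356 (bookkeeping)] -/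
theorem IsRateKey₁₂.isRecordOfRecord₁₂C (hk : IsRateKey₁₂ F N D w θ) : IsRecordOfRecord₁₂C F N D w := ⟨θ, hk⟩

/-- … hence its datum is a Stage-12 datum of record. [cite: Balaban1989LargeFieldII, Thm 1 p.355 (bookkeeping)] -/
theorem IsRateKey₁₂.isDatumOfRecord₁₂C (hk : IsRateKey₁₂ F N D w θ) : IsDatumOfRecord₁₂C F N D :=
  isDatumOfRecord₁₂C_of_isRecordOfRecord₁₂C hk.isRecordOfRecord₁₂C

/-- The key CERTIFIES θ's provisos and admissibility and realises `D` as θ's datum of record. [cite: Balaban1989LargeFieldI, (0.3)–(0.4) p.176 (bookkeeping)] -/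
theorem IsRateKey₁₂.exists_provisos (hk : IsRateKey₁₂ F N D w θ) : ∃ h : θ.Provisos₁₂ F N, θ.Admissible F N ∧ D = datumOfRecord₁₂ F N θ h := by
  obtain ⟨h, hθ, hD, -⟩ := hk
  exact ⟨h, hθ, hD⟩

/-- The key's θ is admissible. [cite: Balaban1987RG1, (1.20)–(1.21) p.264 (hypothesis dictionary; bookkeeping)] -/
theorem IsRateKey₁₂.admissible (hk : IsRateKey₁₂ F N D w θ) : θ.Admissible F N := by
  obtain ⟨-, hθ, -⟩ := hk
  exact hθ

/-- The world's window is positive. [cite: Balaban1987RG1, Thm 1 p.259 (bookkeeping)] -/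
theorem IsRateKey₁₂.gamma_pos (hk : IsRateKey₁₂ F N D w θ) : 0 < w.γ := by
  obtain ⟨-, -, -, -, hγ, -⟩ := hk
  exact hγ.1

/-- The world's window sits inside θ's coupling window: `w.γ ≤ θ.γ`. [cite: Balaban1987RG1, Thm 1 p.259 (bookkeeping)] -/
theorem IsRateKey₁₂.gamma_le (hk : IsRateKey₁₂ F N D w θ) : w.γ ≤ θ.γ := by
  obtain ⟨-, -, -, -, hγ, -⟩ := hk
  exact hγ.2

/-- The world reads θ's block factor. [cite: Balaban1987RG1, (0.1) p.251 (bookkeeping)] -/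
theorem IsRateKey₁₂.L_eq (hk : IsRateKey₁₂ F N D w θ) : w.L = (θ.L : ℝ) := by
  obtain ⟨-, -, -, -, -, hL, -⟩ := hk
  exact hL

/-- The world is bound to the datum's construction. [cite: Balaban1989LargeFieldII, Thm 1 + (0.1) pp.355–356 (bookkeeping)] -/
theorem IsRateKey₁₂.construction_eq (hk : IsRateKey₁₂ F N D w θ) : w.C = D.C := by
  obtain ⟨-, -, -, hC, -⟩ := hk
  exact hC

/-- The upstream block of the world is the C-binding of record at the Stage-12 view. [cite: Balaban1989LargeFieldII, Thm 1 + (0.1) pp.355–356 (bookkeeping)] -/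
theorem IsRateKey₁₂.up_eq (hk : IsRateKey₁₂ F N D w θ) (P : B12.RunParams) : w.up P = upOfRecord₅C F N (θ.toStage5₁₂ F N) P := by
  obtain ⟨-, -, -, -, -, -, hup⟩ := hk
  exact hup P

end Key

section Assignments

/-- **THE RESIDUAL RATE ASSIGNMENT, STAGE 12**: the rate objects of the construction with family `F`, Stage-12 parameters `θ`, tuned bare sequence `g₀`, loop string
`os` (RR-1's container `RateObjects₁₁`) — an EXPLICIT parameter of the (T-RATE) record at Stage 12, pinned later by name; no law assumed. [cite: Balaban1987RG1, (1.18)–(1.22) pp.263–264 (objects only)] -/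
abbrev RateAssignment₁₂ (N : ℕ) [NeZero N] := (F : T4Family) → Stage12Params F N → (ℕ → ℝ) → List (ULoop F) → RateObjects₁₁ N

/-- **THE RESIDUAL SPINE ASSIGNMENT, STAGE 12**, likewise (RR-1's container `SpineObjects₁₁`), read by the (T-SPINE) record at Stage 12. [cite: Balaban1987RG1, (0.24)–(0.27) pp.257–258 (objects only)] -/
abbrev SpineAssignment₁₂ (N : ℕ) [NeZero N] := (F : T4Family) → Stage12Params F N → (ℕ → ℝ) → List (ULoop F) → SpineObjects₁₁

variable (N : ℕ) [NeZero N]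

/-- A rate assignment typed over the Stage-9 part lifts to Stage 12 (`Stage12Params extends Stage9Params`). [cite: Balaban1987RG1, (1.18)–(1.22) pp.263–264 (bookkeeping)] -/
def RateAssignment₁₂.ofStage9 (a : (F : T4Family) → Stage9Params F N → (ℕ → ℝ) → List (ULoop F) → RateObjects₁₁ N) : RateAssignment₁₂ N :=
  fun F θ g₀ os => a F θ.toStage9Params g₀ os

/-- … and reads, at `θ`, the Stage-9 assignment at `θ.toStage9Params` (`rfl`). [cite: Balaban1987RG1, (1.18)–(1.22) pp.263–264 (bookkeeping)] -/
theorem RateAssignment₁₂.ofStage9_apply (a : (F : T4Family) → Stage9Params F N → (ℕ → ℝ) → List (ULoop F) → RateObjects₁₁ N) (F : T4Family)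
    (θ : Stage12Params F N) (g₀ : ℕ → ℝ) (os : List (ULoop F)) : RateAssignment₁₂.ofStage9 N a F θ g₀ os = a F θ.toStage9Params g₀ os := rfl

/-- A spine assignment typed over the Stage-9 part lifts to Stage 12. [cite: Balaban1987RG1, (0.24)–(0.27) pp.257–258 (bookkeeping)] -/
def SpineAssignment₁₂.ofStage9 (s : (F : T4Family) → Stage9Params F N → (ℕ → ℝ) → List (ULoop F) → SpineObjects₁₁) : SpineAssignment₁₂ N :=
  fun F θ g₀ os => s F θ.toStage9Params g₀ os

/-- … `rfl` face. [cite: Balaban1987RG1, (0.24)–(0.27) pp.257–258 (bookkeeping)] -/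
theorem SpineAssignment₁₂.ofStage9_apply (s : (F : T4Family) → Stage9Params F N → (ℕ → ℝ) → List (ULoop F) → SpineObjects₁₁) (F : T4Family)
    (θ : Stage12Params F N) (g₀ : ℕ → ℝ) (os : List (ULoop F)) : SpineAssignment₁₂.ofStage9 N s F θ g₀ os = s F θ.toStage9Params g₀ os := rfl

/-- Every Stage-12 rate-assignment type is inhabited (the constant assignments at RR-1's trivial objects; class consistency only, NO content).
[cite: Balaban1987RG1, (1.20)–(1.22) p.264 (bookkeeping)] -/
theorem nonempty_rateAssignment₁₂ : Nonempty (RateAssignment₁₂ N) :=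
  let ⟨o⟩ := nonempty_rateObjects₁₁ N
  ⟨fun _ _ _ _ => o⟩

/-- … with the letter signs satisfiable at every argument. [cite: Balaban1987RG1, (1.20)–(1.22) p.264 (bookkeeping)] -/
theorem exists_rateAssignment₁₂_signs : ∃ a : RateAssignment₁₂ N, ∀ (F : T4Family) (θ : Stage12Params F N) (g₀ : ℕ → ℝ) (os : List (ULoop F)),
    (a F θ g₀ os).u3.Signs :=
  let ⟨o, ho⟩ := nonempty_rateObjects₁₁_signs N
  ⟨fun _ _ _ _ => o, fun _ _ _ _ => ho⟩

/-- … and the Stage-12 spine assignments. [cite: Balaban1987RG1, (0.24)–(0.27) pp.257–258 (bookkeeping)] -/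
theorem nonempty_spineAssignment₁₂ : Nonempty (SpineAssignment₁₂ N) :=
  let ⟨s⟩ := nonempty_spineObjects₁₁
  ⟨fun _ _ _ _ => s⟩

end Assignments

end Literature.MathematicalPhysics.QuantumFieldTheory.Balaban1983to89.Node00

end
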